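import Mathlib
import HarnessLib

/-!
# Format C: Hilbert–Schmidt bound for off-diagonal kernels `|K(n,m)| ≤ c/(min(n,m)·|n−m|)` on the far modes

Route context: Fourier–Galerkin / Schur-complement certificates of Weil positivity on a window ("format C";
cell memo `run/shared/lean/pub/rh-explicit/rh-explicit-weil-10/FORMATC-DESIGN.md` §4.3, EXP_off and the ρ-part of
DIG_off; supporting stmt-RiemannHypothesis-0098).  Two off-diagonal pieces of the far sector Gram have entries bounded
by `c/(min(n,m)·|n−m|)` (`c = 2Ea/π²` for the exponential sums, `c = 4a/π²` for the digamma remainders, since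
`n + m ≥ min(n,m)`); §4.3 bounds their operator norm by the Hilbert–Schmidt norm
`(Σ_{n≠m>M₁} c²/(min² (n−m)²))^{1/2} ≤ c·π·(2/(3M₁))^{1/2}`.  THIS FILE proves a double-sum estimate of the same
shape on finite truncations `M₁ < n, m ≤ N`, with the elementary constants `Σ_{k≥1} k⁻² ≤ 2` and `Σ_{n>M₁} n⁻² ≤ 1/M₁`
(telescoping) and the crude symmetric majorant `c²/(n²(n−m)²) + c²/(m²(n−m)²)`, i.e. `Σ_{n≠m} K(n,m)² ≤ 8c²/M₁`
(a factor `√2`–`1.1` weaker than §4.3's `π√(2/3)·c/√M₁`; immaterial at the sizes used, `c/√M₁ ≈ 10⁻²`):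

* `WeilFormatC.sum_Ioc_inv_sq_le` — `Σ_{n=M₁+1}^{N} 1/n² ≤ 1/M₁` (`1 ≤ M₁`);
* `WeilFormatC.sum_Icc_inv_sq_le_two` — `Σ_{k=1}^{N} 1/k² ≤ 2`;
* `WeilFormatC.sum_sum_sq_le_of_offDiag_bound` — **if `K n n = 0` and `|K n m| ≤ c/(min(n,m)|n−m|)` for `n ≠ m` in
  `(M₁, N]`, then `Σ_n Σ_m K(n,m)² ≤ 4c²/M₁`** — to be combined with `WeilFormatC.sq_bilin_le_hsNormSq`
  (`WeilFormatCMatrixNormBounds.lean`): `|yᵀKy| ≤ (2c/√M₁)‖y‖²`.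

Elementary; standard axioms only.
-/

-- `Summit.RiemannHypothesis.RiemannHypothesis.…` is the layout-mandated namespace (summit = problem name).
set_option linter.dupNamespace false

namespace Summit.RiemannHypothesis.RiemannHypothesis.Theorems.WeilFormatC

open Finset

/-- Telescoping: `Σ_{n=M₁+1}^{N} 1/n² ≤ 1/M₁` for `1 ≤ M₁` (`1/n² ≤ 1/(n−1) − 1/n`). -/
theorem sum_Ioc_inv_sq_le {M₁ N : ℕ} (hM : 1 ≤ M₁) :
    ∑ n ∈ Finset.Ioc M₁ N, 1 / ((n : ℝ) ^ 2) ≤ 1 / (M₁ : ℝ) := by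
  -- termwise `1/n² ≤ 1/(n-1) - 1/n`, then telescope
  have hterm : ∀ n ∈ Finset.Ioc M₁ N, 1 / ((n : ℝ) ^ 2) ≤ 1 / ((n : ℝ) - 1) - 1 / (n : ℝ) := by
    intro n hn
    have hn1 : M₁ < n := (Finset.mem_Ioc.mp hn).1
    have hn2 : (2 : ℝ) ≤ n := by exact_mod_cast (show 2 ≤ n by omega)
    have hpos : (0 : ℝ) < (n : ℝ) - 1 := by linarith
    have hposn : (0 : ℝ) < n := by linarith
    rw [div_sub_div _ _ hpos.ne' hposn.ne', div_le_div_iff₀ (by positivity) (by positivity)]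
    nlinarith
  refine (Finset.sum_le_sum hterm).trans ?_
  -- telescoping sum over Ioc M₁ N of f(n-1) - f(n) with f k = 1/k
  have htel : ∀ K : ℕ, M₁ ≤ K →
      ∑ n ∈ Finset.Ioc M₁ K, (1 / ((n : ℝ) - 1) - 1 / (n : ℝ)) = 1 / (M₁ : ℝ) - 1 / (K : ℝ) := by
    intro K hK
    induction K, hK using Nat.le_induction with
    | base => simp
    | succ K hK ih =>
        rw [Finset.sum_Ioc_succ_top (by omega), ih]
        push_cast
        ring
  rcases le_or_gt M₁ N with hMN | hMN
  · rw [htel N hMN]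
    have : (0 : ℝ) ≤ 1 / (N : ℝ) := by positivity
    linarith
  · rw [Finset.Ioc_eq_empty (by omega)]
    simp

/-- `Σ_{k=1}^{N} 1/k² ≤ 2` (`1 + Σ_{k≥2} (1/(k−1) − 1/k)`). -/
theorem sum_Icc_inv_sq_le_two (N : ℕ) : ∑ k ∈ Finset.Icc 1 N, 1 / ((k : ℝ) ^ 2) ≤ 2 := by
  rcases Nat.eq_zero_or_pos N with rfl | hN
  · simp
  have hsplit : Finset.Icc 1 N = insert 1 (Finset.Ioc 1 N) := by
    ext k; simp only [Finset.mem_Icc, Finset.mem_insert, Finset.mem_Ioc]; omega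
  rw [hsplit, Finset.sum_insert (by simp)]
  have h := sum_Ioc_inv_sq_le (M₁ := 1) (N := N) le_rfl
  norm_num at h ⊢
  linarith

/-- **Hilbert–Schmidt double sum for an off-diagonal kernel.**  On the modes `M₁ < n, m ≤ N` (`1 ≤ M₁`), if `K n n = 0`
and `|K n m| ≤ c/(min(n,m)·|n − m|)` for `n ≠ m`, then `Σ_n Σ_m K(n,m)² ≤ 8c²/M₁`
(`K² ≤ c²/(n²(n−m)²) + c²/(m²(n−m)²)`, symmetrise, `Σ_{m≠n} 1/(n−m)² ≤ 2Σ_{k≥1}k⁻² ≤ 4`, `Σ_{n>M₁} n⁻² ≤ 1/M₁`). -/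
theorem sum_sum_sq_le_of_offDiag_bound {M₁ N : ℕ} (hM : 1 ≤ M₁) (K : ℕ → ℕ → ℝ) {c : ℝ} (hc : 0 ≤ c)
    (hdiag : ∀ n, K n n = 0)
    (hK : ∀ n ∈ Finset.Ioc M₁ N, ∀ m ∈ Finset.Ioc M₁ N, n ≠ m →
      |K n m| ≤ c / ((min n m : ℕ) * |(n : ℝ) - m|)) :
    ∑ n ∈ Finset.Ioc M₁ N, ∑ m ∈ Finset.Ioc M₁ N, K n m ^ 2 ≤ 8 * c ^ 2 / M₁ := by
  set s := Finset.Ioc M₁ N with hs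
  have hM0 : (0 : ℝ) < M₁ := by exact_mod_cast hM
  -- entrywise bound of the square by the symmetric majorant B(n,m) = c²/(n²(n-m)²) + c²/(m²(n-m)²) (n ≠ m), 0 on the diagonal
  have hpos : ∀ n ∈ s, (0 : ℝ) < n := fun n hn ↦ by
    have := (Finset.mem_Ioc.mp hn).1; exact_mod_cast (by omega : 0 < n)
  have hentry : ∀ n ∈ s, ∀ m ∈ s, K n m ^ 2
      ≤ (if n = m then 0 else c ^ 2 / ((n : ℝ) ^ 2 * ((n : ℝ) - m) ^ 2) + c ^ 2 / ((m : ℝ) ^ 2 * ((n : ℝ) - m) ^ 2)) := by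
    intro n hn m hm
    by_cases hnm : n = m
    · subst hnm; simp [hdiag]
    · rw [if_neg hnm]
      have hb := hK n hn m hm hnm
      have hn0 := hpos n hn; have hm0 := hpos m hm
      have hd : (0 : ℝ) < |(n : ℝ) - m| := abs_pos.mpr (sub_ne_zero.mpr (by exact_mod_cast hnm))
      have hmin0 : (0 : ℝ) < ((min n m : ℕ) : ℝ) := by
        have : 0 < min n m := lt_min (by exact_mod_cast hn0) (by exact_mod_cast hm0); exact_mod_cast this
      -- K² ≤ c²/(min² d²) ≤ c²/(n² d²) + c²/(m² d²)
      have h1 : K n m ^ 2 ≤ c ^ 2 / (((min n m : ℕ) : ℝ) ^ 2 * ((n : ℝ) - m) ^ 2) := by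
        have h0 : 0 ≤ c / (((min n m : ℕ) : ℝ) * |(n : ℝ) - m|) := by positivity
        have := pow_le_pow_left₀ (abs_nonneg _) hb 2
        rw [sq_abs] at this
        refine this.trans (le_of_eq ?_)
        rw [div_pow, mul_pow, sq_abs]
      refine h1.trans ?_
      rcases le_total n m with hle | hle
      · rw [min_eq_left hle]
        have : 0 ≤ c ^ 2 / ((m : ℝ) ^ 2 * ((n : ℝ) - m) ^ 2) := by positivity
        linarith
      · rw [min_eq_right hle]
        have : 0 ≤ c ^ 2 / ((n : ℝ) ^ 2 * ((n : ℝ) - m) ^ 2) := by positivity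
        linarith
  refine (Finset.sum_le_sum fun n hn ↦ Finset.sum_le_sum fun m hm ↦ hentry n hn m hm).trans ?_
  -- the majorant splits into two equal double sums (swap n ↔ m in the second)
  have hsym : ∑ n ∈ s, ∑ m ∈ s, (if n = m then (0 : ℝ) else
        c ^ 2 / ((n : ℝ) ^ 2 * ((n : ℝ) - m) ^ 2) + c ^ 2 / ((m : ℝ) ^ 2 * ((n : ℝ) - m) ^ 2))
      = 2 * ∑ n ∈ s, ∑ m ∈ s, (if n = m then (0 : ℝ) else c ^ 2 / ((n : ℝ) ^ 2 * ((n : ℝ) - m) ^ 2)) := by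
    have e1 : ∑ n ∈ s, ∑ m ∈ s, (if n = m then (0 : ℝ) else
        c ^ 2 / ((n : ℝ) ^ 2 * ((n : ℝ) - m) ^ 2) + c ^ 2 / ((m : ℝ) ^ 2 * ((n : ℝ) - m) ^ 2))
        = ∑ n ∈ s, ∑ m ∈ s, (if n = m then (0 : ℝ) else c ^ 2 / ((n : ℝ) ^ 2 * ((n : ℝ) - m) ^ 2))
          + ∑ n ∈ s, ∑ m ∈ s, (if n = m then (0 : ℝ) else c ^ 2 / ((m : ℝ) ^ 2 * ((n : ℝ) - m) ^ 2)) := by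
      rw [← Finset.sum_add_distrib]
      refine Finset.sum_congr rfl fun n _ ↦ ?_
      rw [← Finset.sum_add_distrib]
      refine Finset.sum_congr rfl fun m _ ↦ ?_
      split_ifs <;> ring
    have e2 : ∑ n ∈ s, ∑ m ∈ s, (if n = m then (0 : ℝ) else c ^ 2 / ((m : ℝ) ^ 2 * ((n : ℝ) - m) ^ 2))
        = ∑ n ∈ s, ∑ m ∈ s, (if n = m then (0 : ℝ) else c ^ 2 / ((n : ℝ) ^ 2 * ((n : ℝ) - m) ^ 2)) := by
      rw [Finset.sum_comm]
      refine Finset.sum_congr rfl fun n _ ↦ Finset.sum_congr rfl fun m _ ↦ ?_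
      by_cases h : n = m
      · subst h; simp
      · rw [if_neg (Ne.symm h), if_neg h]; ring
    rw [e1, e2, two_mul]
  rw [hsym]
  -- inner sum over m for fixed n: Σ_{m ≠ n} 1/(n-m)² ≤ 2 · Σ_{k=1}^{N} 1/k² ≤ 4
  have hinner : ∀ n ∈ s, ∑ m ∈ s, (if n = m then (0 : ℝ) else c ^ 2 / ((n : ℝ) ^ 2 * ((n : ℝ) - m) ^ 2))
      ≤ c ^ 2 / (n : ℝ) ^ 2 * 4 := by
    intro n hn
    have hn0 := hpos n hn
    -- pull out c²/n²
    have e : ∑ m ∈ s, (if n = m then (0 : ℝ) else c ^ 2 / ((n : ℝ) ^ 2 * ((n : ℝ) - m) ^ 2))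
        = c ^ 2 / (n : ℝ) ^ 2 * ∑ m ∈ s, (if n = m then (0 : ℝ) else 1 / ((n : ℝ) - m) ^ 2) := by
      rw [Finset.mul_sum]
      refine Finset.sum_congr rfl fun m _ ↦ ?_
      split_ifs
      · simp
      · field_simp
    rw [e]
    refine mul_le_mul_of_nonneg_left ?_ (by positivity)
    -- split s into m < n and m > n; each part is a sum of 1/k² over distinct k ≥ 1
    have hlt : ∑ m ∈ s.filter (· < n), 1 / ((n : ℝ) - m) ^ 2 ≤ 2 := by
      have hinj : ∑ m ∈ s.filter (· < n), 1 / ((n : ℝ) - m) ^ 2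
          = ∑ k ∈ (s.filter (· < n)).image (fun m ↦ n - m), 1 / ((k : ℝ)) ^ 2 := by
        rw [Finset.sum_image]
        · refine Finset.sum_congr rfl fun m hm ↦ ?_
          have : m < n := (Finset.mem_filter.mp hm).2
          push_cast [Nat.cast_sub this.le]
          ring
        · intro x hx y hy hxy
          have hx' : x < n := (Finset.mem_filter.mp hx).2
          have hy' : y < n := (Finset.mem_filter.mp hy).2
          simp only at hxy
          omega
      rw [hinj]
      refine le_trans (Finset.sum_le_sum_of_subset_of_nonneg (t := Finset.Icc 1 N) ?_ ?_) (sum_Icc_inv_sq_le_two N)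
      · intro k hk
        obtain ⟨m, hm, rfl⟩ := Finset.mem_image.mp hk
        have hm' := Finset.mem_filter.mp hm
        have hms := Finset.mem_Ioc.mp hm'.1
        have hns := Finset.mem_Ioc.mp hn
        simp only [Finset.mem_Icc]; omega
      · intro k _ _; positivity
    have hgt : ∑ m ∈ s.filter (fun m ↦ n < m), 1 / ((n : ℝ) - m) ^ 2 ≤ 2 := by
      have hinj : ∑ m ∈ s.filter (fun m ↦ n < m), 1 / ((n : ℝ) - m) ^ 2
          = ∑ k ∈ (s.filter (fun m ↦ n < m)).image (fun m ↦ m - n), 1 / ((k : ℝ)) ^ 2 := by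
        rw [Finset.sum_image]
        · refine Finset.sum_congr rfl fun m hm ↦ ?_
          have : n < m := (Finset.mem_filter.mp hm).2
          push_cast [Nat.cast_sub this.le]
          ring
        · intro x hx y hy hxy
          have hx' : n < x := (Finset.mem_filter.mp hx).2
          have hy' : n < y := (Finset.mem_filter.mp hy).2
          simp only at hxy
          omega
      rw [hinj]
      refine le_trans (Finset.sum_le_sum_of_subset_of_nonneg (t := Finset.Icc 1 N) ?_ ?_) (sum_Icc_inv_sq_le_two N)
      · intro k hk
        obtain ⟨m, hm, rfl⟩ := Finset.mem_image.mp hk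
        have hm' := Finset.mem_filter.mp hm
        have hms := Finset.mem_Ioc.mp hm'.1
        have hns := Finset.mem_Ioc.mp hn
        simp only [Finset.mem_Icc]; omega
      · intro k _ _; positivity
    -- assemble: the `if` sum = sum over m < n plus sum over m > n
    have hsplit : ∑ m ∈ s, (if n = m then (0 : ℝ) else 1 / ((n : ℝ) - m) ^ 2)
        = ∑ m ∈ s.filter (· < n), 1 / ((n : ℝ) - m) ^ 2 + ∑ m ∈ s.filter (fun m ↦ n < m), 1 / ((n : ℝ) - m) ^ 2 := by
      rw [← Finset.sum_filter_add_sum_filter_not s (fun m ↦ m < n)]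
      congr 1
      · refine Finset.sum_congr rfl fun m hm ↦ ?_
        have : m < n := (Finset.mem_filter.mp hm).2
        rw [if_neg (by omega)]
      · rw [← Finset.sum_filter_add_sum_filter_not (s.filter fun m ↦ ¬m < n) (fun m ↦ n < m)]
        have hz : ∑ m ∈ (s.filter fun m ↦ ¬m < n).filter (fun m ↦ ¬n < m),
            (if n = m then (0 : ℝ) else 1 / ((n : ℝ) - m) ^ 2) = 0 := by
          refine Finset.sum_eq_zero fun m hm ↦ ?_
          have h1 := (Finset.mem_filter.mp hm).2
          have h2 := (Finset.mem_filter.mp (Finset.mem_filter.mp hm).1).2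
          have : n = m := by omega
          rw [if_pos this]
        rw [hz, add_zero, Finset.filter_filter]
        have hset : s.filter (fun m ↦ ¬m < n ∧ n < m) = s.filter (fun m ↦ n < m) := by
          ext m; simp only [Finset.mem_filter]; constructor
          · rintro ⟨h1, _, h3⟩; exact ⟨h1, h3⟩
          · rintro ⟨h1, h3⟩; exact ⟨h1, by omega, h3⟩
        rw [hset]
        refine Finset.sum_congr rfl fun m hm ↦ ?_
        have : n < m := (Finset.mem_filter.mp hm).2
        rw [if_neg (by omega)]
    rw [hsplit]
    linarith
  -- sum over n
  calc 2 * ∑ n ∈ s, ∑ m ∈ s, (if n = m then (0 : ℝ) else c ^ 2 / ((n : ℝ) ^ 2 * ((n : ℝ) - m) ^ 2))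
      ≤ 2 * ∑ n ∈ s, c ^ 2 / (n : ℝ) ^ 2 * 4 := by
        gcongr with n hn; exact hinner n hn
    _ = 8 * c ^ 2 * ∑ n ∈ s, 1 / (n : ℝ) ^ 2 := by
        rw [Finset.mul_sum, Finset.mul_sum]; refine Finset.sum_congr rfl fun n _ ↦ by ring
    _ ≤ 8 * c ^ 2 * (1 / M₁) := by
        gcongr; exact sum_Ioc_inv_sq_le hM
    _ = 8 * c ^ 2 / M₁ := by ring

end Summit.RiemannHypothesis.RiemannHypothesis.Theorems.WeilFormatC
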